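import Mathlib
import HarnessLib
import Summits.QuantumFields.YangMills.Theses.PencilRigidity
import Literature.MathematicalPhysics.QuantumFieldTheory.OSReconstructionNoE1Proofs
import Summits.QuantumFields.YangMills.Theorems.PencilRigidityCurvatureKernelBoundKernelPinning
import Summits.QuantumFields.YangMills.Theorems.PencilRigidityCurvatureKernelBoundHalfSpaceKernelBumps
import Summits.QuantumFields.YangMills.Theorems.PencilRigidityCurvatureKernelBoundHalfSpaceKernelCluster
import Summits.QuantumFields.YangMills.Theorems.PencilRigidityCurvatureKernelBoundHalfSpaceKernelRiemann
import Summits.QuantumFields.YangMills.Theorems.PencilRigidityCurvatureKernelBoundHalfSpaceKernelRiemannLimit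
import Summits.QuantumFields.YangMills.Theorems.PencilRigidityCurvatureKernelBoundHalfSpaceKernelRiemannNorm

/-!
# `CurvatureKernelBound` — stub H `HalfSpaceKernel`: the identification `⟪Φ, Ψ_u⟫ = ∫ u(c) ⟪Φ, T(c)Ψ⟫`

(support for stmt-QuantumFields-11687, line `sixteen-charts-analytic-kernel`, skeleton v11)

`inner_fieldVec_ofRealTest_eq_integral` (real `u`) and `inner_fieldVec_eq_integral_complex`. Headline (registered
sub-goal): `ReImDecomposition`.
-/

noncomputable section

open scoped BigOperators Topology SchwartzMap ComplexConjugate InnerProductSpace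
open MeasureTheory Filter Set Metric
open Literature.MathematicalPhysics.QuantumLattice Literature.MathematicalPhysics.AQFT
open Literature.MathematicalPhysics.QuantumFieldTheory
open Literature.MathematicalPhysics.QuantumLattice.SchwingerFamily (timeVec)

namespace Summit.QuantumFields.YangMills.Theorems.CurvatureKernel

section Identification

variable (ϖ : (EuclideanSpace ℝ (Fin 4)) → ℝ) (hϖc : Continuous ϖ) (hϖ0 : ∀ x, 0 ≤ ϖ x) (hϖ1 : ∀ x, ϖ x ≤ 1)
  (hϖsupp : tsupport ϖ ⊆ Metric.closedBall (0 : (EuclideanSpace ℝ (Fin 4))) 2)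
  (hϖle : ∀ (N : ℕ) (y : (EuclideanSpace ℝ (Fin 4))), ∑ j ∈ Fintype.piFinset (fun _ : Fin 4 => Finset.Icc (-(N : ℤ)) N),
    ϖ (y - WithLp.toLp 2 (fun i => ((j i : ℤ) : ℝ))) ≤ 1)
  (hϖeq : ∀ (N : ℕ) (y : (EuclideanSpace ℝ (Fin 4))), (∀ i : Fin 4, |y i| ≤ N) →
    ∑ j ∈ Fintype.piFinset (fun _ : Fin 4 => Finset.Icc (-(N : ℤ)) N), ϖ (y - WithLp.toLp 2 (fun i => ((j i : ℤ) : ℝ))) = 1)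
  (hI : 0 < ∫ x, ϖ x)
  (b : ℕ → (EuclideanSpace ℝ (Fin 4)) → 𝓢(EuclideanSpace ℝ (Fin 4), ℝ))
  (hb : ∀ (n : ℕ) (c x : EuclideanSpace ℝ (Fin 4)), b n c x = ϖ ((((n : ℝ) + 2)) • (x - c)))
  {S : SchwingerFamily (EuclideanSpace ℝ (Fin 4))} (h : OSReconstructionNoE1 S.toLabelled)
  (htr : (∀ (n : ℕ) (a : (EuclideanSpace ℝ (Fin 4))) (F : SchwartzMap (Fin n → (EuclideanSpace ℝ (Fin 4))) ℂ), IsOffDiagonal F → S n (translateMulti a F) = S n F))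
  (𝒰 : Ultrafilter ℕ) (h𝒰 : (↑𝒰 : Filter ℕ) ≤ atTop)

include hϖc hϖ0 hϖle hϖeq hI htr h𝒰 in
/-- **The identification** (stub H, core): at base height `p` with local two-point bound `LB(S,p,r₀,A,B)`,
bump vectors `wₙ = (Δₙ⁴∫ϖ)⁻¹ Ψ_{b n (p e₀)}` bounded by `Cw` with weak `𝒰`-cluster vector `Ψ`, and a REAL test
function `u` supported in `B̄(q, R)` well above height `p` (`4R ≤ r₀`, `4R ≤ p`, `p + 2R ≤ q⁰`):
`⟪Φ, Ψ_u⟫ = ∫ u(c) ⟪Φ, e^{-(c⁰−p)H} U(c⃗) Ψ⟫ dc` for every `Φ`. Riemann sums of translated bumps converge to `u`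
uniformly (exact partition of unity), hence in the OS norm (local two-point bound carried down to height `p` by
the contraction semigroup and spatial translation invariance); their field vectors are finite combinations of
`e^{-(c⁰−p)H}U(c⃗) wₙ`; equicontinuity in `c` and the weak limit along `𝒰` give the integral. [folklore] -/
theorem inner_fieldVec_ofRealTest_eq_integral
    (p r₀ A B : ℝ) (hA : 0 ≤ A) (hB : 0 ≤ B)
    (hLB : (∀ (r : ℝ), 0 < r → r ≤ r₀ → ∀ (f : Fin 2 → SchwartzMap (EuclideanSpace ℝ (Fin 4)) ℝ) (F : SchwartzMap (Fin 2 → (EuclideanSpace ℝ (Fin 4))) ℂ) (M₀ M₁ : ℝ), IsTensorOf F (fun i => ofRealTest (f i)) → tsupport ((f 0 : SchwartzMap (EuclideanSpace ℝ (Fin 4)) ℝ) : (EuclideanSpace ℝ (Fin 4)) → ℝ) ⊆ Metric.closedBall (EuclideanSpace.single (0 : Fin 4) (-p)) r → tsupport ((f 1 : SchwartzMap (EuclideanSpace ℝ (Fin 4)) ℝ) : (EuclideanSpace ℝ (Fin 4)) → ℝ) ⊆ Metric.closedBall (EuclideanSpace.single (0 : Fin 4) p) r → (∀ x, |f 0 x|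 ≤ M₀) → (∀ x, |f 1 x| ≤ M₁) → ‖S 2 F‖ ≤ A * (∫ x : (EuclideanSpace ℝ (Fin 4)), |f 0 x|) * (∫ x : (EuclideanSpace ℝ (Fin 4)), |f 1 x|) + B * r ^ 8 * M₀ * M₁))
    (w : ℕ → h.Hilbert)
    (hw : ∀ (n : ℕ) (hn : 2 * ((n : ℝ) + 2)⁻¹ < (EuclideanSpace.single (0 : Fin 4) p : EuclideanSpace ℝ (Fin 4)) 0),
      w n = ((((((n : ℝ) + 2)⁻¹) ^ 4 * ∫ x, ϖ x)⁻¹ : ℝ) : ℂ) •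
        h.fieldVec 1 (fun _ => ()) _ (isTimeOrdered_tensorFin_one (tsupport_ofRealTest_bump_pos ϖ hϖsupp b hb n hn)))
    (Cw : ℝ) (hCw : ∀ n, ‖w n‖ ≤ Cw)
    (Ψ : h.Hilbert) (hΨ : ∀ Φ : h.Hilbert, Tendsto (fun n => ⟪Φ, w n⟫_ℂ) (↑𝒰 : Filter ℕ) (𝓝 ⟪Φ, Ψ⟫_ℂ))
    (u : 𝓢(EuclideanSpace ℝ (Fin 4), ℝ)) (q : EuclideanSpace ℝ (Fin 4)) (R : ℝ) (hR : 0 < R)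
    (hu : tsupport (u : EuclideanSpace ℝ (Fin 4) → ℝ) ⊆ Metric.closedBall q R)
    (hRr : 4 * R ≤ r₀) (hRp : 4 * R ≤ p) (hq : p + 2 * R ≤ q 0)
    (hupos : tsupport ((ofRealTest u : 𝓢(EuclideanSpace ℝ (Fin 4), ℂ)) : EuclideanSpace ℝ (Fin 4) → ℂ) ⊆ {y | 0 < y 0})
    (Φ : h.Hilbert) :
    ⟪Φ, h.fieldVec 1 (fun _ => ()) _ (isTimeOrdered_tensorFin_one hupos)⟫_ℂ =
      ∫ c : EuclideanSpace ℝ (Fin 4), (u c : ℂ) * ⟪Φ, h.transfer (c 0 - p) (h.translate c Ψ)⟫_ℂ := by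
  -- ### notation
  set I : ℝ := ∫ x, ϖ x with hIdef
  set cP : EuclideanSpace ℝ (Fin 4) := EuclideanSpace.single 0 p with hcP
  have hcP0 : cP 0 = p := by simp [hcP]
  -- the operators `T c = e^{-(c⁰-p)H} U(c⃗)` as matrix elements against `Φ`
  set Φc : EuclideanSpace ℝ (Fin 4) → h.Hilbert := fun c => h.translate (-c) (h.transfer (c 0 - p) Φ) with hΦc
  have hΦc_cont : Continuous Φc :=
    continuous_translate_transfer_comp h Φ ((EuclideanSpace.proj (0 : Fin 4)).continuous.sub continuous_const) continuous_neg
  have hadj : ∀ (c : EuclideanSpace ℝ (Fin 4)) (X : h.Hilbert),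
      ⟪Φ, h.transfer (c 0 - p) (h.translate c X)⟫_ℂ = ⟪Φc c, X⟫_ℂ := fun c X =>
    inner_transfer_translate_eq_inner_adjoint h Φ X _ _
  set Gn : ℕ → EuclideanSpace ℝ (Fin 4) → ℂ := fun n c => ⟪Φc c, w n⟫_ℂ with hGn
  set G' : EuclideanSpace ℝ (Fin 4) → ℂ := fun c => ⟪Φc c, Ψ⟫_ℂ with hG'
  have hG'_cont : Continuous G' := hΦc_cont.inner continuous_const
  have hGn_cont : ∀ n, Continuous (Gn n) := fun n => hΦc_cont.inner continuous_const
  -- the goal in terms of `G'`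
  have hgoal : ∫ c : EuclideanSpace ℝ (Fin 4), (u c : ℂ) * ⟪Φ, h.transfer (c 0 - p) (h.translate c Ψ)⟫_ℂ =
      ∫ c, (u c : ℂ) * G' c :=
    integral_congr_ae (Eventually.of_forall fun c => by show (u c : ℂ) * _ = (u c : ℂ) * G' c; rw [hadj])
  rw [hgoal]
  -- ### scales, grids, Riemann sums
  have hΔpos : ∀ n : ℕ, (0 : ℝ) < ((n : ℝ) + 2)⁻¹ := fun n => by positivity
  have hΔ : Tendsto (fun n : ℕ => ((n : ℝ) + 2)⁻¹) atTop (𝓝 0) :=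
    tendsto_inv_atTop_zero.comp (tendsto_natCast_atTop_atTop.atTop_add tendsto_const_nhds)
  -- grid points
  set gpt : ℕ → (Fin 4 → ℤ) → EuclideanSpace ℝ (Fin 4) := fun n j => ((n : ℝ) + 2)⁻¹ • WithLp.toLp 2 (fun i => ((j i : ℤ) : ℝ)) with hgpt
  -- cube sizes: `N n Δ n ≥ ‖q‖ + R + 1`
  set N : ℕ → ℕ := fun n => ⌈(‖q‖ + R + 1) * ((n : ℝ) + 2)⌉₊ with hN
  have hNΔ : ∀ n : ℕ, ‖q‖ + R + 1 ≤ (N n : ℝ) * ((n : ℝ) + 2)⁻¹ := by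
    intro n
    have h1 : (‖q‖ + R + 1) * ((n : ℝ) + 2) ≤ N n := Nat.le_ceil _
    have h2 : (0 : ℝ) < (n : ℝ) + 2 := by positivity
    rw [← div_eq_mul_inv, le_div_iff₀ h2]
    exact h1
  -- the exactness region contains `B̄(q, R + 1)` once `4Δ ≤ 1`
  have hregion : ∀ n : ℕ, 4 * ((n : ℝ) + 2)⁻¹ ≤ 1 → ∀ x ∈ Metric.closedBall q (R + 2 * ((n : ℝ) + 2)⁻¹),
      ∀ i : Fin 4, |x i| + 2 * ((n : ℝ) + 2)⁻¹ ≤ N n * ((n : ℝ) + 2)⁻¹ := by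
    intro n hn x hx i
    rw [Metric.mem_closedBall, dist_eq_norm] at hx
    have h1 : |x i| ≤ ‖x‖ := by simpa using PiLp.norm_apply_le (p := 2) x i
    have h2 : ‖x‖ ≤ ‖q‖ + (R + 2 * ((n : ℝ) + 2)⁻¹) := by
      have := norm_le_norm_add_norm_sub' x q
      rw [norm_sub_rev] at hx
      linarith [norm_sub_rev q x]
    linarith [hNΔ n]
  -- index cubes and the contributing grid points
  set J : ℕ → Finset (Fin 4 → ℤ) := fun n => Fintype.piFinset (fun _ : Fin 4 => Finset.Icc (-(N n : ℤ)) (N n)) with hJ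
  have hgpt_mem : ∀ n j, u (gpt n j) ≠ 0 → gpt n j ∈ Metric.closedBall q R := fun n j hj =>
    hu (subset_tsupport _ (Function.mem_support.2 hj))
  have hgpt0 : ∀ n j, u (gpt n j) ≠ 0 → q 0 - R ≤ gpt n j 0 := by
    intro n j hj
    have h1 := hgpt_mem n j hj
    rw [Metric.mem_closedBall, dist_eq_norm] at h1
    have h2 : |(gpt n j - q) 0| ≤ ‖gpt n j - q‖ := by simpa using PiLp.norm_apply_le (p := 2) (gpt n j - q) 0
    rw [PiLp.sub_apply, abs_le] at h2
    linarith [h2.1]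
  -- ### the scalar Riemann sums (total expressions, no proofs inside)
  set Ssum : ℕ → ℂ := fun n => ∑ j ∈ J n, (u (gpt n j) : ℂ) * ((((n : ℝ) + 2)⁻¹ ^ 4 * I : ℝ) : ℂ) * Gn n (gpt n j)
    with hSsum
  -- ### claim 1: `Ssum n` is eventually `ε`-close to `⟪Φ, Ψ_u⟫` (norm convergence of the Riemann sums in `ℋ`)
  have claim1 : ∀ ε > (0 : ℝ), ∀ᶠ n in atTop,
      ‖Ssum n - ⟪Φ, h.fieldVec 1 (fun _ => ()) _ (isTimeOrdered_tensorFin_one hupos)⟫_ℂ‖ ≤ ε := by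
    intro ε hε
    have h1 := norm_riemannInner_sub_inner_le ϖ hϖ0 hϖsupp hϖle hϖeq hI b hb h htr p r₀ A B hA hB hLB w hw u q R hR hu
      hRr hRp hq hupos Φ N hNΔ ε hε
    refine h1.mono fun n hn => ?_
    have e : Ssum n = ∑ j ∈ J n, (u (gpt n j) : ℂ) * ((((n : ℝ) + 2)⁻¹ ^ 4 * I : ℝ) : ℂ) *
        ⟪Φ, h.transfer (gpt n j 0 - p) (h.translate (gpt n j) (w n))⟫_ℂ := by
      rw [hSsum]
      exact Finset.sum_congr rfl fun j _ => by rw [hGn]; simp only [hadj]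
    rw [e]
    exact hn
  -- ### claim 2: `Ssum n → ∫ u G'` along the ultrafilter (equicontinuity + weak convergence + Riemann sums)
  have claim2 : Tendsto Ssum (↑𝒰 : Filter ℕ) (𝓝 (∫ c, (u c : ℂ) * G' c)) :=
    tendsto_riemannSum_inner ϖ hϖc hϖ0 hϖsupp hϖle hϖeq hI 𝒰 h𝒰 Φc hΦc_cont w Cw hCw Ψ hΨ u q R hR hu N hNΔ
  -- ### conclusion: uniqueness of limits along `𝒰`
  haveI : (↑𝒰 : Filter ℕ).NeBot := Ultrafilter.neBot 𝒰
  have hlim1 : Tendsto Ssum (↑𝒰 : Filter ℕ) (𝓝 ⟪Φ, h.fieldVec 1 (fun _ => ()) _ (isTimeOrdered_tensorFin_one hupos)⟫_ℂ) := by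
    refine Tendsto.mono_left ?_ h𝒰
    rw [Metric.tendsto_nhds]
    intro ε hε
    filter_upwards [claim1 (ε / 2) (half_pos hε)] with n hn
    rw [dist_eq_norm]
    linarith
  exact tendsto_nhds_unique hlim1 claim2

include hϖc hϖ0 hϖle hϖeq hI htr h𝒰 in
/-- **The identification for COMPLEX one-point test functions** (from the real case by linearity in the real and
imaginary parts). [folklore] -/
theorem inner_fieldVec_eq_integral_complex
    (p r₀ A B : ℝ) (hA : 0 ≤ A) (hB : 0 ≤ B)
    (hLB : (∀ (r : ℝ), 0 < r → r ≤ r₀ → ∀ (f : Fin 2 → SchwartzMap (EuclideanSpace ℝ (Fin 4)) ℝ) (F : SchwartzMap (Fin 2 → (EuclideanSpace ℝ (Fin 4))) ℂ) (M₀ M₁ : ℝ), IsTensorOf F (fun i => ofRealTest (f i)) → tsupport ((f 0 : SchwartzMap (EuclideanSpace ℝ (Fin 4)) ℝ) : (EuclideanSpace ℝ (Fin 4)) → ℝ) ⊆ Metric.closedBall (EuclideanSpace.single (0 : Fin 4) (-p)) r → tsupport ((f 1 : SchwartzMap (EuclideanSpace ℝ (Fin 4)) ℝ) : (EuclideanSpace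 ℝ (Fin 4)) → ℝ) ⊆ Metric.closedBall (EuclideanSpace.single (0 : Fin 4) p) r → (∀ x, |f 0 x| ≤ M₀) → (∀ x, |f 1 x| ≤ M₁) → ‖S 2 F‖ ≤ A * (∫ x : (EuclideanSpace ℝ (Fin 4)), |f 0 x|) * (∫ x : (EuclideanSpace ℝ (Fin 4)), |f 1 x|) + B * r ^ 8 * M₀ * M₁))
    (w : ℕ → h.Hilbert)
    (hw : ∀ (n : ℕ) (hn : 2 * ((n : ℝ) + 2)⁻¹ < (EuclideanSpace.single (0 : Fin 4) p : EuclideanSpace ℝ (Fin 4)) 0),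
      w n = ((((((n : ℝ) + 2)⁻¹) ^ 4 * ∫ x, ϖ x)⁻¹ : ℝ) : ℂ) •
        h.fieldVec 1 (fun _ => ()) _ (isTimeOrdered_tensorFin_one (tsupport_ofRealTest_bump_pos ϖ hϖsupp b hb n hn)))
    (Cw : ℝ) (hCw : ∀ n, ‖w n‖ ≤ Cw)
    (Ψ : h.Hilbert) (hΨ : ∀ Φ : h.Hilbert, Tendsto (fun n => ⟪Φ, w n⟫_ℂ) (↑𝒰 : Filter ℕ) (𝓝 ⟪Φ, Ψ⟫_ℂ))
    (α : 𝓢(EuclideanSpace ℝ (Fin 4), ℂ)) (q : EuclideanSpace ℝ (Fin 4)) (R : ℝ) (hR : 0 < R)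
    (hα : tsupport (α : EuclideanSpace ℝ (Fin 4) → ℂ) ⊆ Metric.closedBall q R)
    (hRr : 4 * R ≤ r₀) (hRp : 4 * R ≤ p) (hq : p + 2 * R ≤ q 0)
    (hαpos : tsupport (α : EuclideanSpace ℝ (Fin 4) → ℂ) ⊆ {y | 0 < y 0})
    (Φ : h.Hilbert) :
    ⟪Φ, h.fieldVec 1 (fun _ => ()) _ (isTimeOrdered_tensorFin_one hαpos)⟫_ℂ =
      ∫ c : EuclideanSpace ℝ (Fin 4), α c * ⟪Φ, h.transfer (c 0 - p) (h.translate c Ψ)⟫_ℂ := by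
  -- real and imaginary parts
  set α₁ : 𝓢(EuclideanSpace ℝ (Fin 4), ℝ) := reTest α with hα₁
  set α₂ : 𝓢(EuclideanSpace ℝ (Fin 4), ℝ) := imTest α with hα₂
  have h₁s : tsupport (α₁ : EuclideanSpace ℝ (Fin 4) → ℝ) ⊆ tsupport (α : EuclideanSpace ℝ (Fin 4) → ℂ) := tsupport_reTest_subset α
  have h₂s : tsupport (α₂ : EuclideanSpace ℝ (Fin 4) → ℝ) ⊆ tsupport (α : EuclideanSpace ℝ (Fin 4) → ℂ) := tsupport_imTest_subset α
  have hc : ∀ g : 𝓢(EuclideanSpace ℝ (Fin 4), ℝ), tsupport ((ofRealTest g : 𝓢(EuclideanSpace ℝ (Fin 4), ℂ)) : EuclideanSpace ℝ (Fin 4) → ℂ) ⊆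
      tsupport (g : EuclideanSpace ℝ (Fin 4) → ℝ) := fun g =>
    tsupport_comp_subset (g := fun r : ℝ => (r : ℂ)) Complex.ofReal_zero _
  have h₁pos : tsupport ((ofRealTest α₁ : 𝓢(EuclideanSpace ℝ (Fin 4), ℂ)) : EuclideanSpace ℝ (Fin 4) → ℂ) ⊆ {y | 0 < y 0} :=
    ((hc α₁).trans h₁s).trans hαpos
  have h₂pos : tsupport ((ofRealTest α₂ : 𝓢(EuclideanSpace ℝ (Fin 4), ℂ)) : EuclideanSpace ℝ (Fin 4) → ℂ) ⊆ {y | 0 < y 0} :=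
    ((hc α₂).trans h₂s).trans hαpos
  have hI₂pos : tsupport (((Complex.I • ofRealTest α₂ : 𝓢(EuclideanSpace ℝ (Fin 4), ℂ))) : EuclideanSpace ℝ (Fin 4) → ℂ) ⊆ {y | 0 < y 0} :=
    (tsupport_smul_subset_right (fun _ : EuclideanSpace ℝ (Fin 4) => Complex.I) _).trans h₂pos
  have hdec : α = ofRealTest α₁ + Complex.I • ofRealTest α₂ := by
    ext x
    simp only [hα₁, hα₂, add_apply, smul_apply, ofRealTest_apply, reTest_apply, imTest_apply,
      smul_eq_mul]
    rw [mul_comm]; exact (Complex.re_add_im (α x)).symm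
  have hsumpos : tsupport (((ofRealTest α₁ + Complex.I • ofRealTest α₂ : 𝓢(EuclideanSpace ℝ (Fin 4), ℂ))) : EuclideanSpace ℝ (Fin 4) → ℂ) ⊆ {y | 0 < y 0} := by
    rw [← hdec]; exact hαpos
  have hv : h.fieldVec 1 (fun _ => ()) _ (isTimeOrdered_tensorFin_one hαpos) =
      h.fieldVec 1 (fun _ => ()) _ (isTimeOrdered_tensorFin_one h₁pos) +
        Complex.I • h.fieldVec 1 (fun _ => ()) _ (isTimeOrdered_tensorFin_one h₂pos) := by
    rw [fieldVec_one_congr h (congrArg (fun φ => SchwartzMap.tensorFin 1 ![φ]) hdec) _ (isTimeOrdered_tensorFin_one hsumpos),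
      fieldVec_one_add h h₁pos hI₂pos hsumpos, fieldVec_one_smul h Complex.I h₂pos hI₂pos]
  -- the real identification for both parts
  have hV₁ := inner_fieldVec_ofRealTest_eq_integral ϖ hϖc hϖ0 hϖsupp hϖle hϖeq hI b hb h htr 𝒰 h𝒰 p r₀ A B hA hB hLB w hw Cw hCw
    Ψ hΨ α₁ q R hR (h₁s.trans hα) hRr hRp hq h₁pos Φ
  have hV₂ := inner_fieldVec_ofRealTest_eq_integral ϖ hϖc hϖ0 hϖsupp hϖle hϖeq hI b hb h htr 𝒰 h𝒰 p r₀ A B hA hB hLB w hw Cw hCw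
    Ψ hΨ α₂ q R hR (h₂s.trans hα) hRr hRp hq h₂pos Φ
  -- integrability of the two integrands (Schwartz × bounded continuous)
  set G : EuclideanSpace ℝ (Fin 4) → ℂ := fun c => ⟪Φ, h.transfer (c 0 - p) (h.translate c Ψ)⟫_ℂ with hG
  have hGc : Continuous G := by
    have : Continuous fun c : EuclideanSpace ℝ (Fin 4) => h.translate c (h.transfer (c 0 - p) Ψ) :=
      continuous_translate_transfer_comp h Ψ ((EuclideanSpace.proj (0 : Fin 4)).continuous.sub continuous_const) continuous_id
    simp_rw [hG, ← h.translate_transfer]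
    exact continuous_const.inner this
  have hGb : ∀ c, ‖G c‖ ≤ ‖Φ‖ * ‖Ψ‖ := fun c => by
    refine (norm_inner_le_norm _ _).trans (mul_le_mul_of_nonneg_left ?_ (norm_nonneg _))
    refine (h.norm_transfer_le _ _).trans ?_
    rw [LinearIsometryEquiv.norm_map]
  have hint : ∀ g : 𝓢(EuclideanSpace ℝ (Fin 4), ℝ), Integrable (fun c => (g c : ℂ) * G c) := fun g =>
    (g.integrable.ofReal).mul_bdd hGc.aestronglyMeasurable (ae_of_all _ hGb)
  rw [hv, inner_add_right, inner_smul_right, hV₁, hV₂, ← integral_const_mul, ← integral_add (hint α₁) ((hint α₂).const_mul _)]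
  refine integral_congr_ae (Eventually.of_forall fun c => ?_)
  show (α₁ c : ℂ) * G c + Complex.I * ((α₂ c : ℂ) * G c) = α c * G c
  rw [hdec]
  simp only [add_apply, smul_apply, ofRealTest_apply, smul_eq_mul]
  ring

end Identification

/-- **Sub-goal `ReImDecomposition`** (helper-file headline for stub `HalfSpaceKernel`; registered signature): a complex
test function is the complexified real part plus `i` times the complexified imaginary part. [folklore] -/
theorem ReImDecomposition : open Literature.MathematicalPhysics.QuantumLattice in ∀ (α : SchwartzMap (EuclideanSpace ℝ (Fin 4)) ℂ), α = ofRealTest (reTest α) + Complex.I • ofRealTest (imTest α) := by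
  intro α
  ext x
  simp only [add_apply, smul_apply, ofRealTest_apply, reTest_apply, imTest_apply, smul_eq_mul]
  rw [mul_comm]; exact (Complex.re_add_im (α x)).symm

end Summit.QuantumFields.YangMills.Theorems.CurvatureKernel

end
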